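import Summits.CriticalPhenomena.PercolationContinuityZ3.Theorems.Transplant.HexShadowBlocks
import Summits.CriticalPhenomena.PercolationContinuityZ3.Theorems.Transplant.HexShadowRoutePrep
import HarnessLib

/-!
# HEXAGONAL SHADOWS XXXIII — THE ROUTING: the local surgery at every good point of `U(ω)` from `LocalLinkage`

builds on p205010 (kernel theorem, internal audit signed; external expert review pending) — NOT used in this file.  Lane `prim-bschramm`, seat
`prim-bschramm-p2` (gen 33; class C1b; memo `HOME/bschramm/P2-LATTICES.md` §120); helper file (`--supports stmt-CriticalPhenomena-4575 --as helper`).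
Slab original: `GlueGeom.exists_surgery` of `Literature/…/SlabGluingRouting` (there with the slab's explicit routing `exists_route`; here the routing is the
instance node `HexShadow.LocalLinkage` of «HexShadowRouteData», consumed through the swap-pair/key lemma `exists_routeData_of_localLinkage`).
* §1 complements on the blocks: `mem_RPblk_of` (a point of `D(z) ∩ B_{3n}` off `Z_n` lies in `RP(z)`), the `src'`-side path `σ` when only `hexBall z 1 ∩ B'_n ⊆ D`,
  vertices of `γ_min` over `Z_n` are its last vertex, the sphere lemma (a vertex of `D̄` with a neighbour over `B_{3n} ∖ D` lies over `hexSphere z 3`);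
* §2 **`exists_surgery_of_localLinkage`**: for data in range with `m ≥ 7`, a lattice configuration `ω ∈ 𝒳` and a point `z ∈ U(ω)` off the exceptional sets
  `X₁`, `X₂`, `zBad` and not within `3` of the end of `γ_min(ω)`, a `Surgery` with cleared columns `Dblk Γ z ⊆ hexBall z 3` exists.
[cite: DuminilCopinSidoraviciusTassion2016, §2.3 (proof of Fact 2, pp. 6–7: u', v' first/last visits, w' and π, the three paths)] [cite: NewmanTassionWu2017, §3.2]
-/

noncomputable section

namespace Summit.CriticalPhenomena.PercolationContinuityZ3.Theorems.Transplant

open MeasureTheory Literature.Probability.Percolation Literature.Probability.LatticeModels SimpleGraph Filter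
open scoped Classical Topology

/-- The triangle inequality for `triNorm`, distance form (private copy). [folklore] -/
private theorem triNorm_sub_le₃₃ (u v w : Site 2) : triNorm (u - w) ≤ triNorm (u - v) + triNorm (v - w) := by
  simp only [triNorm, Pi.sub_apply, max_le_iff]
  have l0 := (abs_le_triNorm (u - v)).1; have l1 := (abs_le_triNorm (u - v)).2
  have l2 : |(u - v) 0 + (u - v) 1| ≤ triNorm (u - v) := (le_max_right _ _).trans (le_max_right _ _)
  have m0 := (abs_le_triNorm (v - w)).1; have m1 := (abs_le_triNorm (v - w)).2
  have m2 : |(v - w) 0 + (v - w) 1| ≤ triNorm (v - w) := (le_max_right _ _).trans (le_max_right _ _)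
  simp only [triNorm, Pi.sub_apply] at l0 l1 l2 m0 m1 m2 ⊢
  rw [abs_le] at l0 l1 l2 m0 m1 m2
  refine ⟨abs_le.2 ⟨?_, ?_⟩, abs_le.2 ⟨?_, ?_⟩, abs_le.2 ⟨?_, ?_⟩⟩ <;> linarith

namespace HexShadow

variable {V : Type} {G : SimpleGraph V} {Φ : HexShadow G} [Countable V]

/-! ## §1 Complements -/

omit [Countable V] in
/-- **A point of `D(z) ∩ B_{3n}` off `Z_n` lies in `RP(z)`** (for `z ∈ B_{3n} ∖ Z_n` off `zBad`). [folklore] -/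
theorem mem_RPblk_of {Γ : GlueData} {z : Site 2} (hzbig : z ∈ Φ.big Γ) (hzZ : z ∉ Φ.zSeg Γ) (hzb : z ∉ Φ.zBad Γ) {w : Site 2} (hwD : w ∈ Φ.Dblk Γ z)
    (hwbig : w ∈ Φ.big Γ) (hwZ : w ∉ Φ.zSeg Γ) : w ∈ Φ.RPblk Γ z := by
  have hw3 : w ∈ hexBall z 3 := Φ.Dblk_subset_hexBall Γ z hwD
  rw [Dblk, mem_blk_iff_lin] at hwD
  rw [RPblk, mem_blk_iff_lin]
  rw [mem_big_iff] at hwbig hzbig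
  refine ⟨hwD.1, ?_, by unfold sR; omega⟩
  have htD : ((Φ.tD Γ z : ℕ) : ℤ) = Φ.centre 0 + 6 * Γ.m - z 0 := by unfold tD; omega
  by_cases ht : Φ.zTouch Γ z
  · have htR : Φ.tR Γ z = Φ.tD Γ z - 1 := by simp [tR, ht]
    rw [htR]
    -- `w` is not on the column line of `Z_n` (all its block points are in `Z_n`), and `z` is not on it either
    have hall : ∀ w' ∈ hexBall z 3, w' 0 = Φ.centre 0 + 6 * Γ.m → w' ∈ Φ.zSeg Γ := by
      intro w' hw' h0; by_contra hnot; exact hzb ⟨ht, w', hw', h0, hnot⟩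
    have hw0 : w 0 ≠ Φ.centre 0 + 6 * Γ.m := fun h0 => hwZ (hall w hw3 h0)
    have hz0 : z 0 ≠ Φ.centre 0 + 6 * Γ.m := fun h0 => hzZ (hall z (by rw [mem_hexBall_iff_lin]; omega) h0)
    have hpos : 1 ≤ Φ.tD Γ z := by omega
    have : ((Φ.tD Γ z - 1 : ℕ) : ℤ) = Φ.centre 0 + 6 * Γ.m - z 0 - 1 := by omega
    omega
  · have htR : Φ.tR Γ z = Φ.tD Γ z := by simp [tR, ht]
    rw [htR]; omega

/-- **A vertex of `γ_min` over `Z_n` is its last vertex** (no proper prefix of the minimal path ends in `\overline{Z_n}`). [folklore] -/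
theorem eq_getLast_of_sh_mem_zSeg (Γ : GlueData) {ω : BondConfig V} (hA : ω ∈ Φ.evA Γ) {x : V} (hx : x ∈ Φ.γmin Γ ω) (hxZ : Φ.sh x ∈ Φ.zSeg Γ) :
    x = (Φ.γmin Γ ω).getLast (Φ.γmin_spec Γ hA).1.ne_nil := by
  obtain ⟨hγO, -⟩ := Φ.γmin_spec Γ hA
  have hex : ∃ l, OpenSAP ω (Φ.lift (Φ.big Γ)) (Φ.lift (Φ.src Γ)) (Φ.lift (Φ.zSeg Γ)) l := ⟨_, hγO⟩
  obtain ⟨l₁, l₂, hsplit⟩ := List.append_of_mem hx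
  by_cases hl₂ : l₂ = []
  · subst hl₂
    have : Φ.γmin Γ ω = l₁ ++ [x] := hsplit
    simp only [this, List.getLast_append_of_ne_nil _ (List.cons_ne_nil _ _), List.getLast_singleton]
  · exfalso
    have h := minSAP_prefix_getLast_not_mem (Φ.lift_big_finite Γ) hex (p := l₁ ++ [x]) (s := l₂)
      (by change Φ.γmin Γ ω = _; rw [hsplit]; simp) hl₂ (by simp)
    simp only [List.getLast_append_of_ne_nil _ (List.cons_ne_nil _ _), List.getLast_singleton, mem_lift] at h
    exact h hxZ

omit [Countable V] in
/-- **The sphere lemma**: a vertex over `D(z)` adjacent to a vertex over `B_{3n} ∖ D(z)` lies over `hexSphere z 3` (`hexBall z 3 ∩ B_{3n} ⊆ D(z)` and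
the shadow is `1`-Lipschitz). [cite: DuminilCopinSidoraviciusTassion2016, §2.3, proof of Fact 2 ("u' and v' … on the boundary of B̄_R(z)")] -/
theorem sh_mem_hexSphere_of_adj (Γ : GlueData) (z : Site 2) {x u : V} (hxD : Φ.sh x ∈ Φ.Dblk Γ z) (hadj : G.Adj x u) (hubig : Φ.sh u ∈ Φ.big Γ)
    (huD : Φ.sh u ∉ Φ.Dblk Γ z) : Φ.sh x ∈ hexSphere z 3 := by
  have hx3 : Φ.sh x ∈ hexBall z 3 := Φ.Dblk_subset_hexBall Γ z hxD
  have hu3 : Φ.sh u ∉ hexBall z 3 := fun h => huD (Φ.hexBall_inter_big_subset_Dblk Γ z h hubig)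
  rw [mem_hexBall] at hx3 hu3
  rw [mem_hexSphere]
  have hlip := Φ.lip hadj.symm
  have htri := triNorm_sub_le₃₃ (Φ.sh u) (Φ.sh x) z
  push_cast at hx3 hu3 ⊢
  omega

/-- **The `src'`-side path `σ` from the (P2)-witness** (variant of «HexShadowRoutePrep»'s `exists_sigma_of_mem_U` needing only `hexBall z 1 ∩ B'_n ⊆ D`).
[cite: DuminilCopinSidoraviciusTassion2016, §2.3 (Definition of U(ω), (P2); proof of Fact 2, the path π)] -/
theorem exists_sigma_of_mem_U' (Γ : GlueData) {ω : BondConfig V} {z : Site 2} (hz : z ∈ Φ.U Γ ω) {D : Set (Site 2)}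
    (hD : ∀ q ∈ hexBall z 1, q ∈ Φ.small Γ → q ∈ D) :
    ∃ (w : V) (σ : List V), σ.head? = some w ∧ Φ.sh w ∈ D ∧ σ.IsChain (fun a b => s(a, b) ∈ ω ∧ a ≠ b) ∧ (∀ x ∈ σ, Φ.sh x ∈ Φ.small Γ) ∧
      (∀ x ∈ σ, Φ.sh x ∉ Φ.γcols Γ ω) ∧ (∀ x ∈ σ.tail, Φ.sh x ∉ D) ∧ ∀ h : σ ≠ [], σ.getLast h ∈ Φ.lift (Φ.src' Γ) := by
  obtain ⟨-, -, x₀, hx₀, s', hs', hπ⟩ := hz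
  obtain ⟨π, hπO⟩ := exists_openSAP_of_openConnIn hπ
  have hx₀π : π.head hπO.ne_nil = x₀ := hπO.head_mem hπO.ne_nil
  have hx₀mem : x₀ ∈ π := by rw [← hx₀π]; exact List.head_mem _
  have hx₀D : Φ.sh x₀ ∈ D := hD _ hx₀ (hπO.subset x₀ hx₀mem).1
  obtain ⟨l₁, w, σt, hsplit, hwD, hσt⟩ := exists_last_split (p := fun x => Φ.sh x ∈ D) π ⟨x₀, hx₀mem, hx₀D⟩
  refine ⟨w, w :: σt, rfl, hwD, ?_, ?_, ?_, ?_, ?_⟩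
  · have := hπO.chain
    rw [hsplit] at this
    exact (List.isChain_append.1 this).2.1
  · intro x hx
    exact (hπO.subset x (by rw [hsplit]; exact List.mem_append_right _ hx)).1
  · intro x hx
    exact (hπO.subset x (by rw [hsplit]; exact List.mem_append_right _ hx)).2
  · intro x hx
    exact hσt x hx
  · intro h
    have h1 : (w :: σt).getLast h = π.getLast hπO.ne_nil := by
      simp only [hsplit]
      rw [List.getLast_append_of_ne_nil _ (List.cons_ne_nil _ _)]
    rw [h1]
    have := hπO.last_mem hπO.ne_nil
    rw [Set.mem_singleton_iff] at this
    rw [this]; exact hs'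

/-! ## §2 The surgery at a good point of `U(ω)` -/

/-- **THE LOCAL SURGERY EXISTS AT EVERY GOOD POINT OF `U(ω)`, given `LocalLinkage`** (DST 2016, §2.3, proof of Fact 2: the construction of `ω^{(z)}`, as the
data `HexShadow.Surgery` with cleared columns `D(z) ⊆ hexBall z 3`).  Hypotheses: data in range with `m ≥ 7`; `ω ∈ 𝒳` a lattice configuration; `z ∈ U(ω)` off
the bounded exceptional sets `X₁`, `X₂`, `zBad`, and not within `triNorm`-distance `3` of the end of `γ_min(ω)`.  Steps: `u' = E₁`, `v' = E₂` are the first and last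
visits of `γ_min` to `D̄(z)` (two distinct visits exist: the successor of the vertex over `z` is over `hexBall z 1 ∩ B_{3n} ⊆ D(z)`; the start is over `S_{3n}`,
disjoint from `D(z)`; the end is excluded), both over `RP(z) ∩ hexSphere z 3`; `w'` and `σ` from the `(P2)`-witness; the three paths from `LocalLinkage` with the
order condition from the swap pair; the key condition over `S_{3n}` is vacuous. [cite: DuminilCopinSidoraviciusTassion2016, §2.3, proof of Fact 2 (pp. 6–7)] -/
theorem exists_surgery_of_localLinkage (hL : Φ.LocalLinkage) {Γ : GlueData} (hΓ : Φ.InRange Γ) (hm : 7 ≤ Γ.m) {ω : BondConfig V} (hω : ω ⊆ G.edgeSet)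
    (hX : ω ∈ Φ.evX Γ) {z : Site 2} (hz : z ∈ Φ.U Γ ω) (hX₁ : z ∉ Φ.X₁ Γ) (hX₂ : z ∉ Φ.X₂ Γ) (hzb : z ∉ Φ.zBad Γ)
    (hfar : ∀ v ∈ (Φ.γmin Γ ω).getLast?, z ∉ hexBall (Φ.sh v) 3) :
    ∃ sg : Φ.Surgery Γ ω, sg.D ⊆ hexBall z 3 := by
  have hA : ω ∈ Φ.evA Γ := hX.1.1.1
  obtain ⟨hγO, -⟩ := Φ.γmin_spec Γ hA
  have hzU := hz
  obtain ⟨hzs, ⟨g, hgγ, hgz⟩, -⟩ := hz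
  have hzbig : z ∈ Φ.big Γ := by rw [← hgz]; exact hγO.subset g hgγ
  set D := Φ.Dblk Γ z with hDdef
  have hD3 : D ⊆ hexBall z 3 := Φ.Dblk_subset_hexBall Γ z
  have hDW : D ⊆ Φ.big Γ ∪ Φ.small Γ := Dblk_subset_window hΓ hm hzbig hzs hX₁
  have hadj : ∀ {a b : V}, s(a, b) ∈ ω → G.Adj a b := fun h => (SimpleGraph.mem_edgeSet G).1 (hω h)
  -- `z ∈ D`, `z ∉ Z_n`
  have hz3 : z ∈ hexBall z 3 := by rw [mem_hexBall_iff_lin]; omega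
  have hzD : z ∈ D := Φ.hexBall_inter_big_subset_Dblk Γ z hz3 hzbig
  have hlastD : Φ.sh ((Φ.γmin Γ ω).getLast hγO.ne_nil) ∉ D := by
    intro h
    have := hfar ((Φ.γmin Γ ω).getLast hγO.ne_nil) (by rw [List.getLast?_eq_some_getLast hγO.ne_nil]; rfl)
    exact this (mem_hexBall_comm.1 (hD3 h))
  have hzZ : z ∉ Φ.zSeg Γ := by
    intro hzZ
    have hg := Φ.eq_getLast_of_sh_mem_zSeg Γ hA hgγ (hgz.symm ▸ hzZ)
    apply hlastD
    rw [← hg, hgz]; exact hzD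
  -- the head of `γ` is over `S_{3n}`, off `D̄`
  have hheadD : ∀ h : Φ.γmin Γ ω ≠ [], Φ.sh ((Φ.γmin Γ ω).head h) ∉ D := by
    intro h hD
    exact Dblk_disjoint_src hΓ hm hzs hD (hγO.head_mem h)
  -- two distinct vertices of `γ` over `D`: `g` and its successor
  have htwo : ∃ a ∈ Φ.γmin Γ ω, ∃ b ∈ Φ.γmin Γ ω, a ≠ b ∧ Φ.sh a ∈ D ∧ Φ.sh b ∈ D := by
    obtain ⟨l₁, l₂, hsplit⟩ := List.append_of_mem hgγ
    have hl₂ : l₂ ≠ [] := by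
      rintro rfl
      have : (Φ.γmin Γ ω).getLast hγO.ne_nil = g := by simp only [hsplit, List.getLast_append_of_ne_nil _ (List.cons_ne_nil _ _), List.getLast_singleton]
      apply hlastD; rw [this, hgz]; exact hzD
    obtain ⟨u, l₂', rfl⟩ := List.exists_cons_of_ne_nil hl₂
    have hch := hγO.chain
    rw [hsplit, List.isChain_append] at hch
    have hgu : s(g, u) ∈ ω ∧ g ≠ u := (List.isChain_cons_cons.1 hch.2.1).1
    have huγ : u ∈ Φ.γmin Γ ω := by rw [hsplit]; simp
    refine ⟨g, hgγ, u, huγ, hgu.2, hgz.symm ▸ hzD, ?_⟩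
    have hlip := Φ.lip (hadj hgu.1)
    have hu3 : Φ.sh u ∈ hexBall z 3 := by
      rw [mem_hexBall_iff_lin, ← hgz]
      simp only [triNorm, Pi.sub_apply, max_le_iff, abs_le] at hlip
      omega
    exact Φ.hexBall_inter_big_subset_Dblk Γ z hu3 (hγO.subset u huγ)
  -- the decomposition at the first and last visits
  obtain ⟨p₀, E₁, mid, E₂, s₀, hγeq, hp₀, hs₀, hp₀D, hs₀D, hE₁D, hE₂D⟩ :=
    Φ.γmin_split_at Γ hA D hheadD (fun h => by simpa using hlastD) htwo
  have hE₁γ : E₁ ∈ Φ.γmin Γ ω := by rw [hγeq]; simp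
  have hE₂γ : E₂ ∈ Φ.γmin Γ ω := by rw [hγeq]; simp
  have hE₁₂ : E₁ ≠ E₂ := by
    intro h
    have hnd := hγO.nodup
    rw [hγeq, List.nodup_append] at hnd
    have := (List.nodup_cons.1 hnd.2.1).1
    exact this (by rw [h]; simp)
  -- `E₁`, `E₂` are off `Z_n` (they are not the last vertex)
  have hE₁Z : Φ.sh E₁ ∉ Φ.zSeg Γ := by
    intro hZ
    have h := Φ.eq_getLast_of_sh_mem_zSeg Γ hA hE₁γ hZ
    apply hlastD
    rw [← h]; exact hE₁D
  have hE₂Z : Φ.sh E₂ ∉ Φ.zSeg Γ := by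
    intro hZ
    have h := Φ.eq_getLast_of_sh_mem_zSeg Γ hA hE₂γ hZ
    apply hlastD
    rw [← h]; exact hE₂D
  have hE₁big : Φ.sh E₁ ∈ Φ.big Γ := hγO.subset E₁ hE₁γ
  have hE₂big : Φ.sh E₂ ∈ Φ.big Γ := hγO.subset E₂ hE₂γ
  have hE₁RP : Φ.sh E₁ ∈ Φ.RPblk Γ z := mem_RPblk_of hzbig hzZ hzb hE₁D hE₁big hE₁Z
  have hE₂RP : Φ.sh E₂ ∈ Φ.RPblk Γ z := mem_RPblk_of hzbig hzZ hzb hE₂D hE₂big hE₂Z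
  -- `E₁`, `E₂` are over the sphere: predecessor / successor are over `B_{3n} ∖ D`
  have hch := hγO.chain
  rw [hγeq, List.isChain_append] at hch
  have hE₁S : Φ.sh E₁ ∈ hexSphere z 3 := by
    set u := p₀.getLast hp₀ with hu
    have huE : s(u, E₁) ∈ ω := (hch.2.2 u (by simp [hu, List.getLast?_eq_some_getLast hp₀]) E₁ (by simp)).1
    have hup₀ : u ∈ p₀ := List.getLast_mem hp₀
    have huγ : u ∈ Φ.γmin Γ ω := by rw [hγeq]; exact List.mem_append_left _ hup₀
    exact Φ.sh_mem_hexSphere_of_adj Γ z hE₁D (hadj huE).symm (hγO.subset u huγ) (hp₀D u hup₀)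
  have hE₂S : Φ.sh E₂ ∈ hexSphere z 3 := by
    set u := s₀.head hs₀ with hu
    have h1 := hch.2.1
    rw [List.isChain_cons] at h1
    have h3 := (List.isChain_append.1 (show (mid ++ E₂ :: s₀).IsChain _ from h1.2)).2.1
    rw [List.isChain_cons] at h3
    have hEu : s(E₂, u) ∈ ω := (h3.1 u (by simp [hu, List.head?_eq_some_head hs₀])).1
    have hus₀ : u ∈ s₀ := List.head_mem hs₀
    have huγ : u ∈ Φ.γmin Γ ω := by rw [hγeq]; simp [hus₀]
    exact Φ.sh_mem_hexSphere_of_adj Γ z hE₂D (hadj hEu) (hγO.subset u huγ) (hs₀D u hus₀)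
  -- the `src'`-side path `σ` and `w'`
  obtain ⟨w', σ, hσhead, hw'D, hσchain, hσsmall, hσγ, hσD, hσsrc'⟩ :=
    Φ.exists_sigma_of_mem_U' Γ hzU (D := D) fun q hq hqs => Φ.hexBall_inter_small_subset_Dblk Γ z (hexBall_mono z (by norm_num) hq) hqs
  have hσne : σ ≠ [] := by rintro rfl; simp at hσhead
  have hw'σ : w' ∈ σ := by
    have : σ.head hσne = w' := by rw [List.head?_eq_some_head hσne, Option.some.injEq] at hσhead; exact hσhead
    rw [← this]; exact List.head_mem _
  have hw'γ : Φ.sh w' ∉ Φ.γcols Γ ω := hσγ w' hw'σ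
  have hw'z : Φ.sh w' ≠ z := fun h => hw'γ ⟨g, hgγ, hgz.trans h.symm⟩
  have hw'E₁ : Φ.sh w' ≠ Φ.sh E₁ := fun h => hw'γ ⟨E₁, hE₁γ, h.symm⟩
  have hw'E₂ : Φ.sh w' ≠ Φ.sh E₂ := fun h => hw'γ ⟨E₂, hE₂γ, h.symm⟩
  -- the routing
  obtain ⟨htRD, hsRD⟩ := tR_le_tD (Φ := Φ) Γ z
  obtain ⟨r, hkey⟩ := Φ.exists_routeData_of_localLinkage hL z htRD hsRD (three_le_tR_or_sR hX₂) hE₁₂ hE₁RP hE₁S hE₂RP hE₂S hw'D hw'z hw'E₁ hw'E₂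
  have hRPD : Φ.RPblk Γ z ⊆ D := Φ.RPblk_subset_Dblk Γ z
  have hRPbig : Φ.RPblk Γ z ⊆ Φ.big Γ := RPblk_subset_big hΓ hm hzbig hzs
  refine ⟨⟨D, p₀, E₁, mid, E₂, s₀, r.P, r.c, r.Br, σ, hDW, hγeq, hp₀, hs₀, hp₀D, hs₀D, hE₁D, hE₂D,
    fun x hx => hRPD (r.hP x hx), fun x hx => hRPbig (r.hP x hx), fun x hx => RPblk_disjoint_zSeg hzbig hzZ hzb (r.hP x hx),
    r.hchain, r.hnodup, r.c_mem, r.hBr, r.hBrD, r.hBrchain, r.hBrnodup, r.hBrSP, r.hfwd_of_key hkey, ?_, by rw [r.hBrlast]; exact hσhead,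
    hσchain, hσsmall, hσγ, hσD, hσsrc'⟩, hD3⟩
  -- no structure vertex over `S_{3n}`
  intro v hv hvsrc _
  rw [mem_lift] at hvsrc
  rcases List.mem_append.1 hv with h | h
  · exact absurd hvsrc (Dblk_disjoint_src hΓ hm hzs (hRPD (r.hP v h)))
  · exact absurd hvsrc (Dblk_disjoint_src hΓ hm hzs (r.hBrD v (List.dropLast_subset _ h)))

end HexShadow

end Summit.CriticalPhenomena.PercolationContinuityZ3.Theorems.Transplant

end
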